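import Mathlib
import HarnessLib
import Literature.Probability.MarkovChains.MetropolisHastings
import Summits.Ventures.LatticeQCDFlow.Exactness.TemperedTransitions

/-!
# Re-drawing decoupled coordinates: composition with adjoint pairs, commutation, and the adjoint of the composite

HONEST FRAMING: exact (Metropolis-corrected) sampling algorithms for lattice gauge theory;
figures of merit are autocorrelation/cost numbers at stated couplings and volumes; no
continuum-physics claim.

Venture `LatticeQCDFlow` (cell pub-lqcd), topic `Exactness`; FANOUT row 13 (`eng-snf`,
latflow-snf 0.1.1 `snf.adapters_core.CoreDefectSystem(redraw_decoupled=True)`).  NEW WORK of the cell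
(elementary finite sums); nothing is cited as a fact.

## Setting and content

At the fully open end of a defect protocol some coordinates of the configuration are DECOUPLED:
the target weight is `π (a, b) = πA a · w` (constant in `b`), the sweep kernel acts on the coupled
part `a` only and leaves `b` untouched (`liftKernel K`), and the engine additionally RE-DRAWS `b`
uniformly (`redraw`).  On a finite space `A × B`:

* `MutuallyReversible.comp` — if `(P, Padj)` and `(Q, Qadj)` are mutually reversible (adjoint)
  pairs for the same weight, then so is `(P ∘ Q, Qadj ∘ Padj)` (kernel composition `kcomp P Q`:
  first `P`, then `Q`);
* `liftKernel_mutuallyReversible` — lifting an adjoint pair `(K, Kadj)` for `πA` to `A × B`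
  (identity on `b`) gives an adjoint pair for `π`;
* `redraw_detailedBalance` — the uniform re-draw of `b` is reversible for `π`;
* `comp_liftKernel_redraw_comm` — the lifted kernel and the re-draw COMMUTE;
* `sweepRedraw_mutuallyReversible` — hence `(liftKernel K ∘ redraw, liftKernel Kadj ∘ redraw)` is an
  adjoint pair for `π`: the adjoint of "sweep, then re-draw the decoupled links" is "adjoint sweep,
  then re-draw" — the form used on both the up and the down pass of the engine's tempered
  transitions, whose exactness needs exactly such pairs (`TemperedTransitions.lean`).
-/

namespace Summit.Ventures.LatticeQCDFlow.Exactness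

open Finset
open Literature.Probability.MarkovChains

variable {X : Type*} [Fintype X]

/-! ## Composition of kernels and of adjoint pairs -/

/-- Composition of row kernels: first `P`, then `Q`: `kcomp P Q x z = Σ_y P x y · Q y z`. -/
noncomputable def kcomp (P Q : X → X → ℝ) (x z : X) : ℝ := ∑ y, P x y * Q y z

omit [Fintype X] in
/-- Mutual reversibility is symmetric in the pair (swap the roles of the two kernels). -/
theorem MutuallyReversible.symm {π : X → ℝ} {T Tadj : X → X → ℝ}
    (h : MutuallyReversible π T Tadj) : MutuallyReversible π Tadj T :=
  fun a b => (h b a).symm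

/-- **Adjoint of a composite.**  If `(P, Padj)` and `(Q, Qadj)` are adjoint pairs for `π`, then
`(P ∘ Q, Qadj ∘ Padj)` is an adjoint pair for `π`: `π x (PQ) x z = π z (Qadj Padj) z x`. -/
theorem MutuallyReversible.comp {π : X → ℝ} {P Padj Q Qadj : X → X → ℝ}
    (hP : MutuallyReversible π P Padj) (hQ : MutuallyReversible π Q Qadj) :
    MutuallyReversible π (kcomp P Q) (kcomp Qadj Padj) := by
  intro x z
  unfold kcomp
  rw [mul_sum, mul_sum]
  refine sum_congr rfl fun y _ => ?_
  calc π x * (P x y * Q y z) = (π x * P x y) * Q y z := by ring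
    _ = (π y * Padj y x) * Q y z := by rw [hP x y]
    _ = (π y * Q y z) * Padj y x := by ring
    _ = (π z * Qadj z y) * Padj y x := by rw [hQ y z]
    _ = π z * (Qadj z y * Padj y x) := by ring

/-! ## Product space: a kernel on the coupled part, a uniform re-draw of the decoupled part -/

variable {A B : Type*} [Fintype A] [Fintype B] [DecidableEq A] [DecidableEq B]

/-- A kernel `K` on the coupled coordinates `A`, lifted to `A × B` as the identity on `B`. -/
noncomputable def liftKernel (K : A → A → ℝ) (x y : A × B) : ℝ :=
  K x.1 y.1 * (if y.2 = x.2 then 1 else 0)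

/-- Uniform re-draw of the decoupled coordinates `B` (the coupled part is kept). -/
noncomputable def redraw (A B : Type*) [Fintype B] [DecidableEq A] (x y : A × B) : ℝ :=
  (if y.1 = x.1 then 1 else 0) / (Fintype.card B : ℝ)

omit [Fintype A] [Fintype B] [DecidableEq A] in
/-- Lifting an adjoint pair for `πA` gives an adjoint pair for any weight `π (a, b) = πA a · w`
that is constant in the decoupled coordinates. -/
theorem liftKernel_mutuallyReversible {πA : A → ℝ} {K Kadj : A → A → ℝ} (w : ℝ)
    (h : MutuallyReversible πA K Kadj) :
    MutuallyReversible (fun x : A × B => πA x.1 * w) (liftKernel K) (liftKernel Kadj) := by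
  rintro ⟨a, b⟩ ⟨a', b'⟩
  unfold liftKernel
  by_cases hb : b' = b
  · subst hb
    simp only [if_true]
    calc πA a * w * (K a a' * 1) = (πA a * K a a') * w := by ring
      _ = (πA a' * Kadj a' a) * w := by rw [h a a']
      _ = πA a' * w * (Kadj a' a * 1) := by ring
  · have hb' : ¬ b = b' := fun e => hb e.symm
    simp [hb, hb']

omit [Fintype A] [DecidableEq B] in
/-- The uniform re-draw is reversible (detailed balance) for any weight constant in the
decoupled coordinates — it is a symmetric kernel that does not move the coupled part. -/
theorem redraw_detailedBalance {πA : A → ℝ} (w : ℝ) :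
    DetailedBalance (fun x : A × B => πA x.1 * w) (redraw A B) := by
  rintro ⟨a, b⟩ ⟨a', b'⟩
  unfold redraw
  by_cases ha : a' = a
  · subst ha; simp
  · have ha' : ¬ a = a' := fun e => ha e.symm
    simp [ha, ha']

/-- "Sweep the coupled part, then re-draw the decoupled part" as one kernel:
`kcomp (liftKernel K) redraw (a,b) (a',b') = K a a' / |B|`. -/
theorem comp_liftKernel_redraw (K : A → A → ℝ) (x z : A × B) :
    kcomp (liftKernel K) (redraw A B) x z = K x.1 z.1 / (Fintype.card B : ℝ) := by
  unfold kcomp liftKernel redraw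
  rw [Fintype.sum_prod_type]
  have inner : ∀ a' : A,
      ∑ b' : B, (K x.1 a' * (if b' = x.2 then (1 : ℝ) else 0)) *
          ((if z.1 = a' then (1 : ℝ) else 0) / (Fintype.card B : ℝ)) =
        K x.1 a' * ((if z.1 = a' then (1 : ℝ) else 0) / (Fintype.card B : ℝ)) := by
    intro a'
    rw [Finset.sum_eq_single x.2]
    · rw [if_pos rfl, mul_one]
    · intro b _ hb
      rw [if_neg hb, mul_zero, zero_mul]
    · intro h
      exact absurd (Finset.mem_univ _) h
  simp_rw [inner]
  rw [Finset.sum_eq_single z.1]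
  · rw [if_pos rfl, mul_one_div]
  · intro a _ ha
    have : z.1 ≠ a := fun h => ha h.symm
    rw [if_neg this, zero_div, mul_zero]
  · intro h
    exact absurd (Finset.mem_univ _) h

/-- "Re-draw, then sweep" is the same kernel: `kcomp redraw (liftKernel K) (a,b) (a',b') = K a a' / |B|`. -/
theorem comp_redraw_liftKernel (K : A → A → ℝ) (x z : A × B) :
    kcomp (redraw A B) (liftKernel K) x z = K x.1 z.1 / (Fintype.card B : ℝ) := by
  unfold kcomp liftKernel redraw
  rw [Fintype.sum_prod_type, Finset.sum_eq_single x.1]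
  · rw [Finset.sum_eq_single z.2]
    · rw [if_pos rfl, if_pos rfl, mul_one]
      ring
    · intro b _ hb
      have : z.2 ≠ b := fun h => hb h.symm
      rw [if_neg this, mul_zero, mul_zero]
    · intro h
      exact absurd (Finset.mem_univ _) h
  · intro a _ ha
    refine Finset.sum_eq_zero fun b _ => ?_
    rw [if_neg ha, zero_div, zero_mul]
  · intro h
    exact absurd (Finset.mem_univ _) h

/-- **The lifted sweep and the re-draw commute** (the sweep neither reads nor writes the decoupled
coordinates). -/
theorem comp_liftKernel_redraw_comm (K : A → A → ℝ) :
    kcomp (liftKernel K) (redraw A B) = kcomp (redraw A B) (liftKernel K) := by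
  funext x z
  rw [comp_liftKernel_redraw, comp_redraw_liftKernel]

/-- **Adjoint of "sweep then re-draw".**  If `(K, Kadj)` is an adjoint pair for `πA` on the
coupled coordinates, then `(liftKernel K ∘ redraw, liftKernel Kadj ∘ redraw)` is an adjoint pair for
the product weight: the adjoint of "sweep, then re-draw the decoupled links" is "adjoint sweep, then
re-draw" (by `MutuallyReversible.comp` it is "re-draw, then adjoint sweep", and the two commute). -/
theorem sweepRedraw_mutuallyReversible {πA : A → ℝ} {K Kadj : A → A → ℝ} (w : ℝ)
    (h : MutuallyReversible πA K Kadj) :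
    MutuallyReversible (fun x : A × B => πA x.1 * w)
      (kcomp (liftKernel K) (redraw A B)) (kcomp (liftKernel Kadj) (redraw A B)) := by
  have h1 := (liftKernel_mutuallyReversible (B := B) w h).comp
    (DetailedBalance.mutuallyReversible (redraw_detailedBalance (A := A) (B := B) (πA := πA) w))
  -- h1 : adjoint pair (liftKernel K ∘ redraw, redraw ∘ liftKernel Kadj); commute the second
  rwa [← comp_liftKernel_redraw_comm Kadj] at h1

end Summit.Ventures.LatticeQCDFlow.Exactness
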